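import Literature.NumberTheory.Automorphic.LanglandsTetrahedral
import Literature.NumberTheory.GaloisRepresentations.AdZeroBlochKatoDatum
import Literature.NumberTheory.GaloisRepresentations.ResidualRepUnique
import Literature.NumberTheory.GaloisRepresentations.ChebotarevCosetCyclotomic
import HarnessLib

/-!
# Crux `AdjointLiftingGL3` (stmt-Langlands-16779), line `birth`, stub S6 (`stub_galoisSeed`):
# no quadratic self-twist from the irreducibility of `ad⁰`

Step (3) of the Galois-seed stub: the cuspidal `π = π_g` fed to the Gelbart–Jacquet lift has NO
almost-everywhere quadratic self-twist (`IsQuadraticSelfTwistAE K π` fails for every quadratic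
`K`), because `ad⁰` of the residual representation is absolutely irreducible.  Interface-free:
* `eventually_eq_zero_of_isQuadraticSelfTwistAE` (automorphic): a self-twist forces the middle
  Satake coefficient `a_v` to vanish at almost every place inert in `K`;
* `trace_eq_zero_of_not_mem_of_inert_frobenius` (Chebotarev, proved coset form): trace `0` at the
  Frobenius elements of almost all inert places gives `tr τ = 0` on `Γ_F ∖ Γ_K` (open kernel);
* `not_isAbsIrreducible_adZero_of_trace_eq_zero` (algebra, `2 ≠ 0`): a semisimple
  `τ : G → GL₂(k)` with `tr τ = 0` off an index-two subgroup has `Ad⁰(τ)` REDUCIBLE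
  (Brauer–Nesbitt `τ ≅ τ ⊗ χ_H`; an intertwiner spans a `τ`-stable line of `ad⁰`);
* `not_isQuadraticSelfTwistAE_of_isAbsIrreducible_adZero`: the assembly.
-/

set_option linter.dupNamespace false -- `Summit.Langlands.Langlands` is the mandated namespace

noncomputable section

namespace Summit.Langlands.Langlands.Cruxes.AdjointLiftingGL3.Birth

open scoped MatrixGroups NumberField Polynomial Matrix
open NumberField IsDedekindDomain Field Filter Polynomial
open Literature.NumberTheory.GaloisRepresentations Literature.NumberTheory.Automorphic

/-! ## Algebra: `tr τ = 0` off an index-two subgroup makes `Ad⁰ τ` reducible -/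

section Algebra

variable {G : Type*} [Group G] {k : Type*} [Field k]

/-- **Coordinates of `P M Q` on `ad⁰`**: for a trace-zero `M = (x y; z -x)` and any `P, Q`, the
vector of `(0,0), (0,1), (1,0)` entries of `P M Q` is `adZeroTwoMatrixOf P Q` applied to `(x, y, z)`
(a polynomial identity in the entries). [folklore] -/
theorem adZeroTwoMatrixOf_mulVec (P Q M : Matrix (Fin 2) (Fin 2) k) (hM : M 1 1 = -M 0 0) :
    adZeroTwoMatrixOf k P Q *ᵥ ![M 0 0, M 0 1, M 1 0] =
      ![(P * M * Q) 0 0, (P * M * Q) 0 1, (P * M * Q) 1 0] := by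
  ext i
  fin_cases i <;>
    simp [adZeroTwoMatrixOf, Matrix.mulVec, dotProduct, Fin.sum_univ_three, Matrix.mul_apply,
      Fin.sum_univ_two, hM] <;> ring

/-- **`Ad⁰(P)` acts on coordinates by conjugation**: for a trace-zero `M`,
`glAdZeroTwoFrame k P · (M₀₀, M₀₁, M₁₀) = (N₀₀, N₀₁, N₁₀)` with `N = P M P⁻¹`
(`coe_glAdZeroTwoFrame_apply`). [folklore] -/
theorem glAdZeroTwoFrame_mulVec (P : GL (Fin 2) k) (M : Matrix (Fin 2) (Fin 2) k)
    (hM : M.trace = 0) :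
    ((glAdZeroTwoFrame k P : GL (Fin 3) k) : Matrix (Fin 3) (Fin 3) k) *ᵥ ![M 0 0, M 0 1, M 1 0] =
      ![((P : Matrix (Fin 2) (Fin 2) k) * M * ((P⁻¹ : GL (Fin 2) k) : Matrix (Fin 2) (Fin 2) k)) 0 0,
        ((P : Matrix (Fin 2) (Fin 2) k) * M * ((P⁻¹ : GL (Fin 2) k) : Matrix (Fin 2) (Fin 2) k)) 0 1,
        ((P : Matrix (Fin 2) (Fin 2) k) * M * ((P⁻¹ : GL (Fin 2) k) : Matrix (Fin 2) (Fin 2) k)) 1 0] := by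
  rw [coe_glAdZeroTwoFrame_apply]
  refine adZeroTwoMatrixOf_mulVec _ _ _ ?_
  rw [Matrix.trace_fin_two] at hM
  linear_combination hM

/-- **`tr τ = 0` off an index-two subgroup makes `Ad⁰ τ` reducible.**  Let `k` be a field with
`2 ≠ 0`, `τ : G → GL₂(k)` a homomorphism whose representation on `k²` is semisimple, and
`H ≤ G` a subgroup of index `2` with `tr τ(g) = 0` for all `g ∉ H`.  Then
`Ad⁰ ∘ τ : G → GL₃(k)` (frame `glAdZeroTwoFrame`) is NOT absolutely irreducible: with `χ = χ_H`
the sign character, `τ` and `χ ⊗ τ` are semisimple with the same characteristic polynomials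
(`det(X + M) = det(X − M)` for a trace-zero `2 × 2` matrix), so Brauer–Nesbitt
(`brauerNesbitt_holds`) gives an invertible `A` with `τ(g) A τ(g)⁻¹ = χ(g) A`; taking traces at
some `g ∉ H` gives `tr A = 0`, and the line `k · A ⊆ ad⁰` is `τ`-stable — a proper non-zero
subrepresentation of `Ad⁰ τ`.  (Classically: `τ ≅ τ ⊗ χ_H` iff `τ` is induced from `H`, and then
`ad⁰ τ ⊇ χ_H`.) [folklore] -/
theorem not_isAbsIrreducible_adZero_of_trace_eq_zero :
    ∀ {G : Type*} [Group G] {k : Type*} [Field k], (2 : k) ≠ 0 →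
      ∀ (τ : G →* GL (Fin 2) k) (H : Subgroup G), H.index = 2 →
        (glRepresentation τ).IsSemisimpleRepresentation →
        (∀ g, g ∉ H → ((τ g : GL (Fin 2) k) : Matrix (Fin 2) (Fin 2) k).trace = 0) →
        ¬ IsAbsIrreducible ((glAdZeroTwoFrame k).comp τ) := by
  intro G _ k _ h2 τ H hH hss htr hirr
  classical
  -- the sign character `χ = χ_H : G → kˣ` and its values
  set χ : G →* kˣ := signCharOfIndexTwo (R := k) H hH with hχdef
  have hχval : ∀ g, ((χ g : kˣ) : k) = if g ∈ H then 1 else -1 := fun g => by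
    rw [hχdef, signCharOfIndexTwo_apply]
    split_ifs <;> simp
  have hχsq : ∀ g, ((χ g : kˣ) : k) * ((χ g : kˣ) : k) = 1 := fun g => by
    rw [hχval]; split_ifs <;> ring
  -- the twist `τ' = χ ⊗ τ`
  set sc : kˣ →* GL (Fin 2) k :=
    Units.map ((algebraMap k (Matrix (Fin 2) (Fin 2) k)).toMonoidHom) with hscdef
  have hsc : ∀ u : kˣ, ((sc u : GL (Fin 2) k) : Matrix (Fin 2) (Fin 2) k) =
      algebraMap k (Matrix (Fin 2) (Fin 2) k) (u : k) := fun u => rfl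
  have hcomm : ∀ (u : kˣ) (P : GL (Fin 2) k), Commute (sc u) P := fun u P =>
    Commute.units_of_val (by rw [hsc]; exact Algebra.commutes (u : k) _)
  set τ' : G →* GL (Fin 2) k := MonoidHom.mk' (fun g => sc (χ g) * τ g) (fun a b => by
    simp only [map_mul, mul_assoc]
    congr 1
    rw [← mul_assoc, (hcomm _ _).eq, mul_assoc]) with hτ'def
  have hτ' : ∀ g, ((τ' g : GL (Fin 2) k) : Matrix (Fin 2) (Fin 2) k) =
      ((χ g : kˣ) : k) • ((τ g : GL (Fin 2) k) : Matrix (Fin 2) (Fin 2) k) := fun g => by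
    change (((sc (χ g) * τ g : GL (Fin 2) k)) : Matrix (Fin 2) (Fin 2) k) = _
    rw [Units.val_mul, hsc, ← Algebra.smul_def]
  have hττ' : ∀ g, ((τ g : GL (Fin 2) k) : Matrix (Fin 2) (Fin 2) k) =
      ((χ g : kˣ) : k) • ((τ' g : GL (Fin 2) k) : Matrix (Fin 2) (Fin 2) k) := fun g => by
    rw [hτ', smul_smul, hχsq, one_smul]
  have hact : ∀ (σ : G →* GL (Fin 2) k) (g : G) (v : Fin 2 → k),
      glRepresentation σ g v = ((σ g : GL (Fin 2) k) : Matrix (Fin 2) (Fin 2) k) *ᵥ v :=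
    fun σ g v => rfl
  have hlin : ∀ (σ : G →* GL (Fin 2) k) (g : G),
      (glRepresentation σ g : (Fin 2 → k) →ₗ[k] (Fin 2 → k)) =
        Matrix.toLin' ((σ g : GL (Fin 2) k) : Matrix (Fin 2) (Fin 2) k) :=
    fun σ g => LinearMap.ext fun v => by rw [Matrix.toLin'_apply]; rfl
  -- `τ'` is semisimple: it has the same stable subspaces as `τ`
  let Φ : Subrepresentation (glRepresentation τ) ≃o Subrepresentation (glRepresentation τ') :=
    { toFun := fun W => ⟨W.toSubmodule, fun g v hv => by
        rw [hact, hτ', Matrix.smul_mulVec]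
        exact W.toSubmodule.smul_mem _ (W.apply_mem_toSubmodule g hv)⟩
      invFun := fun W => ⟨W.toSubmodule, fun g v hv => by
        rw [hact, hττ', Matrix.smul_mulVec]
        exact W.toSubmodule.smul_mem _ (W.apply_mem_toSubmodule g hv)⟩
      left_inv := fun W => rfl
      right_inv := fun W => rfl
      map_rel_iff' := Iff.rfl }
  have hss' : (glRepresentation τ').IsSemisimpleRepresentation :=
    (OrderIso.complementedLattice_iff Φ).mp hss
  -- same characteristic polynomials
  have hchar : ∀ g, ((τ g : GL (Fin 2) k) : Matrix (Fin 2) (Fin 2) k).charpoly =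
      ((τ' g : GL (Fin 2) k) : Matrix (Fin 2) (Fin 2) k).charpoly := fun g => by
    by_cases hg : g ∈ H
    · rw [hτ', hχval, if_pos hg, one_smul]
    · rw [hτ', hχval, if_neg hg, Matrix.charpoly_fin_two, Matrix.charpoly_fin_two, Matrix.trace_smul,
        Matrix.det_smul, htr g hg, Fintype.card_fin]
      simp
  -- Brauer–Nesbitt: `τ ≅ τ'`
  obtain ⟨e⟩ := brauerNesbitt_holds (glRepresentation τ) (glRepresentation τ') hss hss' fun g => by
    rw [hlin, hlin, Matrix.charpoly_toLin', Matrix.charpoly_toLin']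
    exact hchar g
  set E : (Fin 2 → k) →ₗ[k] (Fin 2 → k) := e.toIntertwiningMap.toLinearMap with hEdef
  set A : Matrix (Fin 2) (Fin 2) k := LinearMap.toMatrix' E with hAdef
  have hA : ∀ g, A * ((τ g : GL (Fin 2) k) : Matrix (Fin 2) (Fin 2) k) =
      ((τ' g : GL (Fin 2) k) : Matrix (Fin 2) (Fin 2) k) * A := fun g => by
    have h := e.toIntertwiningMap.isIntertwining' g
    rw [hlin, hlin] at h
    have h' := congrArg LinearMap.toMatrix' h
    rwa [LinearMap.toMatrix'_comp, LinearMap.toMatrix'_comp, LinearMap.toMatrix'_toLin',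
      LinearMap.toMatrix'_toLin'] at h'
  -- `τ(g) A τ(g)⁻¹ = χ(g) A`
  have hconj : ∀ g, ((τ g : GL (Fin 2) k) : Matrix (Fin 2) (Fin 2) k) * A *
      (((τ g)⁻¹ : GL (Fin 2) k) : Matrix (Fin 2) (Fin 2) k) = ((χ g : kˣ) : k) • A := fun g => by
    have h1 : A = ((χ g : kˣ) : k) • (((τ g : GL (Fin 2) k) : Matrix (Fin 2) (Fin 2) k) * A *
        (((τ g)⁻¹ : GL (Fin 2) k) : Matrix (Fin 2) (Fin 2) k)) := by
      calc A = A * ((τ g : GL (Fin 2) k) : Matrix (Fin 2) (Fin 2) k) *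
            (((τ g)⁻¹ : GL (Fin 2) k) : Matrix (Fin 2) (Fin 2) k) := by
              rw [mul_assoc, ← Units.val_mul, mul_inv_cancel, Units.val_one, mul_one]
        _ = (((χ g : kˣ) : k) • (((τ g : GL (Fin 2) k) : Matrix (Fin 2) (Fin 2) k) * A)) *
            (((τ g)⁻¹ : GL (Fin 2) k) : Matrix (Fin 2) (Fin 2) k) := by rw [hA g, hτ', smul_mul_assoc]
        _ = _ := by rw [smul_mul_assoc]
    conv_rhs => rw [h1]
    rw [smul_smul, hχsq, one_smul]
  -- `tr A = 0`
  obtain ⟨g₀, hg₀⟩ : ∃ g₀, g₀ ∉ H := by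
    by_contra hall
    push Not at hall
    have htop : H = ⊤ := (Subgroup.eq_top_iff' H).mpr hall
    rw [htop, Subgroup.index_top] at hH
    norm_num at hH
  have htrA : A.trace = 0 := by
    have h := Matrix.trace_units_conj (τ g₀) A
    rw [hconj g₀, Matrix.trace_smul, hχval, if_neg hg₀, smul_eq_mul] at h
    have h2' : (2 : k) * A.trace = 0 := by linear_combination -h
    exact (mul_eq_zero.mp h2').resolve_left h2
  -- `A ≠ 0`
  have hA0 : A ≠ 0 := by
    intro hA0
    have hE : E = 0 := by
      have : LinearMap.toMatrix' E = LinearMap.toMatrix' (0 : (Fin 2 → k) →ₗ[k] (Fin 2 → k)) := by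
        rw [← hAdef, hA0, map_zero]
      exact LinearMap.toMatrix'.injective this
    have h1 : e.toLinearEquiv (Pi.single 0 1) = e.toLinearEquiv 0 := by
      rw [Representation.Equiv.toLinearEquiv_apply, Representation.Equiv.toLinearEquiv_apply,
        ← Representation.IntertwiningMap.coe_toLinearMap, ← hEdef, hE]
      simp
    have h2 := e.toLinearEquiv.injective h1
    have h3 := congrFun h2 0
    simp at h3
  -- the vector `a` of coordinates of `A ∈ ad⁰` and the line it spans
  set a : Fin 3 → k := ![A 0 0, A 0 1, A 1 0] with hadef
  have ha0 : a ≠ 0 := by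
    intro ha
    apply hA0
    have h00 : A 0 0 = 0 := by simpa [hadef] using congrFun ha 0
    have h01 : A 0 1 = 0 := by simpa [hadef] using congrFun ha 1
    have h10 : A 1 0 = 0 := by simpa [hadef] using congrFun ha 2
    have h11 : A 1 1 = 0 := by
      rw [Matrix.trace_fin_two, h00, zero_add] at htrA
      exact htrA
    ext i j
    fin_cases i <;> fin_cases j <;> simp [h00, h01, h10, h11]
  have hinv : ∀ g, ((glAdZeroTwoFrame k (τ g) : GL (Fin 3) k) : Matrix (Fin 3) (Fin 3) k) *ᵥ a =
      ((χ g : kˣ) : k) • a := fun g => by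
    rw [hadef, glAdZeroTwoFrame_mulVec (τ g) A htrA, hconj g]
    ext i
    fin_cases i <;> simp [Matrix.smul_apply]
  set ρ₃ := glRepresentation ((glAdZeroTwoFrame k).comp τ) with hρ₃def
  have hρ₃ : ∀ g v, ρ₃ g v =
      ((glAdZeroTwoFrame k (τ g) : GL (Fin 3) k) : Matrix (Fin 3) (Fin 3) k) *ᵥ v := fun g v => rfl
  let W : Subrepresentation ρ₃ :=
    ⟨k ∙ a, fun g v hv => by
      obtain ⟨t, rfl⟩ := Submodule.mem_span_singleton.mp hv
      rw [hρ₃, Matrix.mulVec_smul, hinv, smul_smul]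
      exact Submodule.mem_span_singleton.mpr ⟨t * ((χ g : kˣ) : k), rfl⟩⟩
  have hW : W.toSubmodule = k ∙ a := rfl
  haveI hsimple : IsSimpleOrder (Subrepresentation ρ₃) := hirr.isIrreducible_glRepresentation
  rcases IsSimpleOrder.eq_bot_or_eq_top W with hbot | htop
  · have h : (k ∙ a) = (⊥ : Submodule k (Fin 3 → k)) := by
      rw [← hW, hbot]; rfl
    have ha : a ∈ (⊥ : Submodule k (Fin 3 → k)) := by
      rw [← h]; exact Submodule.mem_span_singleton_self a
    exact ha0 ((Submodule.mem_bot k).mp ha)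
  · have h : (k ∙ a) = (⊤ : Submodule k (Fin 3 → k)) := by
      rw [← hW, htop]; rfl
    have h1 : Module.finrank k (k ∙ a) = 1 := finrank_span_singleton ha0
    rw [h, finrank_top, Module.finrank_fin_fun] at h1
    norm_num at h1

end Algebra

/-! ## Chebotarev: trace zero at almost all inert Frobenius elements -/

section Chebotarev

/-- **Trace zero at the Frobenius elements of almost all inert places forces trace zero off
`Γ_K`.**  Let `K/F` be a quadratic extension of number fields, `τ : Γ_F → GL_n(k)` a homomorphism
with open kernel (e.g. a residual representation), and suppose that for all but finitely many
finite places `v` of `F` inert in `K` (`quadraticSign K v = -1`) every arithmetic Frobenius above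
`v` has `tr τ = 0`.  Then `tr τ(g) = 0` for every `g ∈ Γ_F ∖ Γ_K`: Chebotarev in the proved coset
form `infinite_setOf_prime_absNorm_frobenius_mul_inv_mem` for `N = ker τ ∩ Γ_K` and the coset of
`g` yields a good place `v` with a Frobenius `Φ ∈ N g`, so `τ Φ = τ g`, `Φ ∉ Γ_K`, inertia above
`v` inside `Γ_K`, whence `v` is inert (`quadraticSign_eq_neg_one_of_signChar`).
[cite: TateGCFT1967, §2.4 (Tchebotarev density theorem, existence form)] -/
theorem trace_eq_zero_of_not_mem_of_inert_frobenius :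
    ∀ {F : Type} [Field F] [NumberField F] (K : Type) [Field K] [NumberField K] [Algebra F K],
      Module.finrank F K = 2 →
      ∀ {k : Type*} [CommRing k] {n : ℕ} (τ : absoluteGaloisGroup F →* GL (Fin n) k),
        IsOpen (τ.ker : Set (absoluteGaloisGroup F)) →
        (∀ᶠ v : HeightOneSpectrum (𝓞 F) in cofinite, quadraticSign K v = -1 →
          ∀ 𝔓 ∈ v.primesAbove, ∀ Φ : absoluteGaloisGroup F, IsArithFrobAt (𝓞 F) Φ 𝔓 →
            ((τ Φ : GL (Fin n) k) : Matrix (Fin n) (Fin n) k).trace = 0) →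
        ∀ g : absoluteGaloisGroup F,
          g ∉ ((absGaloisRestrict F K).range : Subgroup (absoluteGaloisGroup F)) →
          ((τ g : GL (Fin n) k) : Matrix (Fin n) (Fin n) k).trace = 0 := by
  intro F _ _ K _ _ _ h2 k _ n τ hker h g hg
  classical
  haveI : FiniteDimensional F K := Module.finite_of_finrank_eq_succ h2
  obtain ⟨hopen, hindex⟩ := isOpen_range_absGaloisRestrict_and_index F K
  rw [h2] at hindex
  set Hs : Subgroup (absoluteGaloisGroup F) := (absGaloisRestrict F K).range with hHs
  haveI : Hs.Normal := Subgroup.normal_of_index_eq_two hindex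
  set N : Subgroup (absoluteGaloisGroup F) := τ.ker ⊓ Hs with hNdef
  haveI : N.Normal := Subgroup.normal_inf_normal τ.ker Hs
  have hN : IsOpen (N : Set (absoluteGaloisGroup F)) := by
    rw [hNdef, Subgroup.coe_inf]
    exact hker.inter hopen
  set S : Set (HeightOneSpectrum (𝓞 F)) := {v | ¬ (quadraticSign K v = -1 →
      ∀ 𝔓 ∈ v.primesAbove, ∀ Φ : absoluteGaloisGroup F, IsArithFrobAt (𝓞 F) Φ 𝔓 →
        ((τ Φ : GL (Fin n) k) : Matrix (Fin n) (Fin n) k).trace = 0)} with hSdef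
  have hS : S.Finite := by
    rw [hSdef]
    exact Filter.eventually_cofinite.mp h
  have hC := infinite_setOf_prime_absNorm_frobenius_mul_inv_mem N hN g
  obtain ⟨v, ⟨-, hinertia, 𝔓, h𝔓, Φ, hΦ, hΦg⟩, hvS⟩ := (hC.sdiff hS).nonempty
  have hv : quadraticSign K v = -1 → ∀ 𝔓 ∈ v.primesAbove, ∀ Φ : absoluteGaloisGroup F,
      IsArithFrobAt (𝓞 F) Φ 𝔓 → ((τ Φ : GL (Fin n) k) : Matrix (Fin n) (Fin n) k).trace = 0 :=
    not_not.mp hvS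
  -- `τ Φ = τ g`
  have hτΦ : τ Φ = τ g := by
    have h1 : τ (Φ * g⁻¹) = 1 := (MonoidHom.mem_ker).mp hΦg.1
    rwa [map_mul, map_inv, mul_inv_eq_one] at h1
  have hΦK : Φ ∉ Hs := by
    intro hΦK
    apply hg
    have : g = (Φ * g⁻¹)⁻¹ * Φ := by group
    rw [this]
    exact Hs.mul_mem (Hs.inv_mem hΦg.2) hΦK
  have hunr : ∀ 𝔓' ∈ v.primesAbove, ∀ γ ∈ 𝔓'.inertia (absoluteGaloisGroup F),
      signCharOfIndexTwo (R := ℂ) _ hindex γ = 1 := fun 𝔓' h𝔓' γ hγ =>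
    signCharOfIndexTwo_apply_of_mem hindex (hinertia 𝔓' h𝔓' hγ).2
  have hsign : quadraticSign K v = -1 :=
    quadraticSign_eq_neg_one_of_signChar K hindex hunr h𝔓 hΦ
      (signCharOfIndexTwo_apply_of_not_mem hindex hΦK)
  rw [← hτΦ]
  exact hv hsign 𝔓 h𝔓 Φ hΦ

end Chebotarev

/-! ## Automorphic: a self-twist kills the middle Satake coefficient at inert places -/

section Automorphic

-- `AutomorphicRepData (AutomorphyDatum.gl n F _)` needs classical decidability
open scoped Classical

/-- **A quadratic self-twist forces `a_v = 0` at almost all inert places.**  If `π` on `GL₂(𝔸_F)`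
has Satake parameters `α_v` with `∏_{x ∈ α_v}(X − x) = X² − a_v X + e_v` at almost all `v`, and
`α_v` is stable under multiplication by `ε_{K/F}(v)` at almost all `v` (`IsQuadraticSelfTwistAE`),
then `a_v = 0` at almost every `v` inert in `K` (`ε_{K/F}(v) = -1`): `{-x, -y} = {x, y}` has sum
`-(x + y) = x + y`, so `a_v = x + y = 0` in `ℂ`. [cite: Gelbart1997, Thm. 5.3.2 (ii) ("unless π is
monomial")] -/
theorem eventually_eq_zero_of_isQuadraticSelfTwistAE :
    ∀ {F : Type} [Field F] [NumberField F] (K : Type) [Field K] [NumberField K] [Algebra F K]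
      {hF : isCompact_glFiniteIntegralLevel 2 F} (π : AutomorphicRepData (AutomorphyDatum.gl 2 F hF))
      (a e : HeightOneSpectrum (𝓞 F) → ℂ),
      (∀ᶠ v : HeightOneSpectrum (𝓞 F) in cofinite, ∃ α : Multiset ℂ,
        π.HasSatakeParamAt v α ∧ satakePolynomial α = X ^ 2 - C (a v) * X + C (e v)) →
      IsQuadraticSelfTwistAE K π →
      ∀ᶠ v : HeightOneSpectrum (𝓞 F) in cofinite, quadraticSign K v = -1 → a v = 0 := by
  intro F _ _ K _ _ _ hF π a e hsat hself
  filter_upwards [hsat, hself] with v hv hst hsign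
  obtain ⟨α, hα, hpoly⟩ := hv
  have hstab := hst α hα
  rw [hsign] at hstab
  -- `α = {x, y}` with `x + y = a v`
  have hcard : Multiset.card α = 2 := by
    have hd := natDegree_satakePolynomial α
    rw [hpoly] at hd
    have h2 : (X ^ 2 - C (a v) * X + C (e v) : ℂ[X]).natDegree = 2 := by compute_degree!
    omega
  obtain ⟨x, y, rfl⟩ := Multiset.card_eq_two.1 hcard
  have hsum : x + y = a v := by
    have h1 := congrArg (fun P : ℂ[X] => P.coeff 1) hpoly
    simp only [satakePolynomial, Multiset.insert_eq_cons, Multiset.map_cons, Multiset.map_singleton,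
      Multiset.prod_cons, Multiset.prod_singleton] at h1
    have e1 : ((X - C x) * (X - C y) : ℂ[X]).coeff 1 = -(x + y) := by
      have : ((X - C x) * (X - C y) : ℂ[X]) = X ^ 2 - C (x + y) * X + C (x * y) := by
        simp only [map_add, map_mul]; ring
      rw [this]
      simp [coeff_X_pow, coeff_C]
    have e2 : (X ^ 2 - C (a v) * X + C (e v) : ℂ[X]).coeff 1 = -(a v) := by
      simp [coeff_X_pow, coeff_C]
    rw [e1, e2, neg_inj] at h1
    exact h1
  have hsums := congrArg Multiset.sum hstab
  simp only [Multiset.insert_eq_cons, Multiset.map_cons, Multiset.map_singleton, Multiset.sum_cons,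
    Multiset.sum_singleton] at hsums
  rw [← hsum]
  linear_combination hsums / (-2)

end Automorphic

/-! ## Assembly -/

section Assembly

open scoped Classical

/-- **No quadratic self-twist when `ad⁰` of the residual representation is absolutely
irreducible.**  Let `π` on `GL₂(𝔸_F)` have Satake parameters with `∏ (X − x) = X² − a_v X + e_v`
at almost all `v`; let `τ : Γ_F → GL₂(k)` (`k` a field with `2 ≠ 0`) be a homomorphism with open
kernel, semisimple on `k²`, whose trace vanishes at the Frobenius elements above almost every `v`
with `a_v = 0` (the residual shadow of "`tr ρ_g(Frob_v) = a_v`"), and with `Ad⁰ ∘ τ` absolutely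
irreducible.  Then `π` has no almost-everywhere quadratic self-twist by any quadratic `K/F`:
otherwise `a_v = 0` at almost all inert `v` (`eventually_eq_zero_of_isQuadraticSelfTwistAE`), so
`tr τ = 0` off `Γ_K` (`trace_eq_zero_of_not_mem_of_inert_frobenius`), so `Ad⁰ τ` is reducible
(`not_isAbsIrreducible_adZero_of_trace_eq_zero`).  This is the input "π not monomial" of the
Gelbart–Jacquet lift in the Galois-seed stub. [cite: Gelbart1997, Thm. 5.3.2 (ii)] -/
theorem not_isQuadraticSelfTwistAE_of_isAbsIrreducible_adZero :
    ∀ {F : Type} [Field F] [NumberField F] {hF : isCompact_glFiniteIntegralLevel 2 F}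
      (π : AutomorphicRepData (AutomorphyDatum.gl 2 F hF)) (a e : HeightOneSpectrum (𝓞 F) → ℂ)
      {k : Type*} [Field k], (2 : k) ≠ 0 → ∀ (τ : absoluteGaloisGroup F →* GL (Fin 2) k),
      IsOpen (τ.ker : Set (absoluteGaloisGroup F)) →
      (glRepresentation τ).IsSemisimpleRepresentation →
      IsAbsIrreducible ((glAdZeroTwoFrame k).comp τ) →
      (∀ᶠ v : HeightOneSpectrum (𝓞 F) in cofinite, ∃ α : Multiset ℂ,
        π.HasSatakeParamAt v α ∧ satakePolynomial α = X ^ 2 - C (a v) * X + C (e v)) →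
      (∀ᶠ v : HeightOneSpectrum (𝓞 F) in cofinite, a v = 0 →
        ∀ 𝔓 ∈ v.primesAbove, ∀ Φ : absoluteGaloisGroup F, IsArithFrobAt (𝓞 F) Φ 𝔓 →
          ((τ Φ : GL (Fin 2) k) : Matrix (Fin 2) (Fin 2) k).trace = 0) →
      ∀ (K : Type) [Field K] [NumberField K] [Algebra F K], Module.finrank F K = 2 →
        ¬ IsQuadraticSelfTwistAE K π := by
  intro F _ _ hF π a e k _ h2 τ hker hss hirr hsat hdict K _ _ _ hK hself
  classical
  haveI : FiniteDimensional F K := Module.finite_of_finrank_eq_succ hK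
  obtain ⟨-, hindex⟩ := isOpen_range_absGaloisRestrict_and_index F K
  rw [hK] at hindex
  have hzero := eventually_eq_zero_of_isQuadraticSelfTwistAE K π a e hsat hself
  have htr : ∀ g : absoluteGaloisGroup F,
      g ∉ ((absGaloisRestrict F K).range : Subgroup (absoluteGaloisGroup F)) →
        ((τ g : GL (Fin 2) k) : Matrix (Fin 2) (Fin 2) k).trace = 0 :=
    trace_eq_zero_of_not_mem_of_inert_frobenius K hK τ hker
      ((hzero.and hdict).mono fun v hv hsign => hv.2 (hv.1 hsign))
  exact not_isAbsIrreducible_adZero_of_trace_eq_zero h2 τ _ hindex hss htr hirr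

end Assembly

end Summit.Langlands.Langlands.Cruxes.AdjointLiftingGL3.Birth

end
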